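import Mathlib
import Literature.Probability.LatticeModels.ProdBernoulliIndependence
import Literature.Probability.Percolation.SharpnessDCTProofs
import Literature.Probability.Percolation.PercolationProofs
import HarnessLib

/-!
# Hub piece lemma (heart of the ordering bound)

Stub `stub_hubPiece` of line `SketchR2I5` (Cycle 3) for the crux `PercNearOneGluing.NearOneGluing`
(item stmt-CriticalPhenomena-4574 = Kozma–Nitzan Conjecture 3, typed over all finite weighted graphs).

Setting: one finite weighted graph — vertices `Fin n`, weights `w`, `μ = prodBernoulli w` on bond
configurations `ω : Set (Sym2 (Fin n))`; relay set `A`, source `o`, target `b`.  Fix a vertex set `U`, a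
vertex `v ∉ U` and a relay-free `K` with `o ∈ K ⊆ U`.  Events:
* `E = {𝒦_U = K} := {ω | ∀ x, x ∈ K ↔ o ↔ x inside U}` (the open cluster of `o` INSIDE `U` is exactly `K`);
* `Piv := {∃ a ∈ A, o ↔ a inside insert v U}`;
* `I₁ := {∃ x ∈ K, s(x, v) open} ∩ {∃ a ∈ A, v ↔ a inside insert v (U \ K)}`;
* `I₂ := {Φ_K ω ∈ openConn v b}` for the *hub-modified* configuration
  `Φ_K ω := (ω ∪ pairs(K, K)) \ pairs(K, U \ K)` (all pairs inside `K` opened, all pairs from `K` to the rest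
  of `U` removed).

With `F :=` the pairs `s(x, y)`, `x ∈ K`, `y ∈ U` (pairs inside `U` meeting `K`):
* `hubPiece_determinedBy_cluster`: `E` is determined by `F` (an open `U`-path from `o` never leaves `K` on
  `E`, so it only uses pairs of `F`);
* `hubPiece_piv_iff`: on `E`, `Piv ↔ I₁` (the last exit of an open `(insert v U)`-path from `K` goes to `v`,
  since any other endpoint would join the cluster; the rest of the path avoids `K`);
* `hubPiece_reachable_of_hub`, `hubPiece_mem_openConn`: on `E ∩ I₁ ∩ I₂`, `o ↔ b` (lift a `Φ_K ω`-path: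
  a pair inside `K` is replaced by the open `ω`-path through `o`, removed pairs are never used);
* `I₁`, `I₂` are increasing and determined by `Fᶜ` (`Φ_K` overwrites exactly the pairs of `F`);
* `hubPiece_assembly`: disjoint-support independence (`prodBernoulli_real_inter_of_determinedBy`) and
  Harris (`prodBernoulli_harris`) give
  `μ(E ∩ I₁ ∩ I₂) = μ(E) μ(I₁ ∩ I₂) ≥ μ(E) μ(I₁) μ(I₂) = μ(Piv ∩ E) μ(I₂)`, whence
  `μ(Piv ∩ E ∩ {o ↮ b}) ≤ μ(Piv ∩ E) − μ(E ∩ I₁ ∩ I₂) ≤ μ(Piv ∩ E) (1 − μ I₂) = μ(Piv ∩ E) μ(I₂ᶜ)`,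
  which is `stub_hubPiece`.
-/

namespace Summit.CriticalPhenomena.PercolationContinuityZ3.Theorems

open MeasureTheory Set Literature.Probability.LatticeModels Literature.Probability.Percolation
open scoped Classical BigOperators

section HubPiece

variable {n : ℕ}

/-! ### Path surgery on the event `{𝒦_U = K}` -/

/-- On `{𝒦_U = K}` (`o ∈ K`), every vertex of `K` is joined to `o` by an open path inside `K`: an open
`U`-path from `o` cannot leave `K` (its first exit would join a vertex outside `K` to `o` inside `U`). -/
theorem hubPiece_pathIn_of_mem {U K : Finset (Fin n)} {o : Fin n} {ω : Set (Sym2 (Fin n))}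
    (hE : ∀ x : Fin n, x ∈ K ↔ ω ∈ openConnIn (↑U : Set (Fin n)) o x) (ho : o ∈ K) {x : Fin n}
    (hx : x ∈ K) : PathIn (openGraph ω) (↑K : Set (Fin n)) o x := by
  have hp : PathIn (openGraph ω) (↑U : Set (Fin n)) o x := DCT16.pathIn_of_mem_openConnIn ((hE x).1 hx)
  rcases hp.exit_or (R := (↑K : Set (Fin n))) (Finset.mem_coe.2 ho) with h | ⟨a, c, -, hc, hcU, hac, hpa⟩
  · exact h.mono Set.inter_subset_left
  · exfalso
    have hpa' : PathIn (openGraph ω) (↑U : Set (Fin n)) o a := hpa.mono Set.inter_subset_right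
    exact hc (Finset.mem_coe.2 ((hE c).2 (DCT16.mem_openConnIn_of_pathIn (hpa'.tail hac hcU))))

/-- **Locality of the cluster inside `U`.**  `{𝒦_U = K}` (`o ∈ K ⊆ U`) is determined by any pair set
containing the pairs `s(x, y)`, `x ∈ K`, `y ∈ U`. -/
theorem hubPiece_determinedBy_cluster {U K : Finset (Fin n)} {o : Fin n} (ho : o ∈ K) (hKU : K ⊆ U)
    {F : Set (Sym2 (Fin n))} (hF : ∀ x ∈ K, ∀ y ∈ U, s(x, y) ∈ F) :
    DeterminedBy {ω : Set (Sym2 (Fin n)) | ∀ x : Fin n, x ∈ K ↔ ω ∈ openConnIn (↑U : Set (Fin n)) o x} F := by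
  rw [determinedBy_iff]
  suffices key : ∀ ω ω' : Set (Sym2 (Fin n)), ω ∩ F = ω' ∩ F →
      (∀ x : Fin n, x ∈ K ↔ ω ∈ openConnIn (↑U : Set (Fin n)) o x) →
      (∀ x : Fin n, x ∈ K ↔ ω' ∈ openConnIn (↑U : Set (Fin n)) o x) from
    fun ω ω' h => ⟨key ω ω' h, key ω' ω h.symm⟩
  intro ω ω' h hE x
  have hKF : (↑K : Set (Fin n)).sym2 ⊆ F := by
    intro e he
    revert he
    induction e using Sym2.ind with
    | _ a c =>
      intro he
      obtain ⟨ha, hc⟩ := Set.mk_mem_sym2_iff.1 he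
      exact hF a (Finset.mem_coe.1 ha) c (hKU (Finset.mem_coe.1 hc))
  constructor
  · intro hx
    have hp : PathIn (openGraph ω') (↑K : Set (Fin n)) o x :=
      DCT16.pathIn_congr_of_inter_eq hKF h (hubPiece_pathIn_of_mem hE ho hx)
    exact DCT16.mem_openConnIn_of_pathIn (hp.mono (Finset.coe_subset.2 hKU))
  · intro hx
    have hp : PathIn (openGraph ω') (↑U : Set (Fin n)) o x := DCT16.pathIn_of_mem_openConnIn hx
    refine DCT16.pathIn_induction (fun z => z ∈ K) hp ho fun a c _ hcU haK hac => ?_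
    have hac' : (openGraph ω).Adj a c :=
      (DCT16.openGraph_adj_congr h (hF a haK c (Finset.mem_coe.1 hcU))).2 hac
    have hpa : PathIn (openGraph ω) (↑U : Set (Fin n)) o a :=
      (hubPiece_pathIn_of_mem hE ho haK).mono (Finset.coe_subset.2 hKU)
    exact (hE c).2 (DCT16.mem_openConnIn_of_pathIn (hpa.tail hac' hcU))

/-- **Exit through `v`.**  On `{𝒦_U = K}` (`o ∈ K ⊆ U`, `v ∉ U`, `K ∩ A = ∅`), `o` reaches a relay inside
`insert v U` iff some pair `s(x, v)`, `x ∈ K`, is open and `v` reaches a relay inside `insert v (U \ K)`: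
the last exit of an open `o–a` path from `K` goes to `v` (any other outer endpoint lies in `U` and would
belong to the cluster), and the remainder of the path avoids `K`. -/
theorem hubPiece_piv_iff {A U K : Finset (Fin n)} {o v : Fin n} (ho : o ∈ K) (hKU : K ⊆ U) (hvU : v ∉ U)
    (hKA : Disjoint K A) {ω : Set (Sym2 (Fin n))}
    (hE : ∀ x : Fin n, x ∈ K ↔ ω ∈ openConnIn (↑U : Set (Fin n)) o x) :
    (∃ a ∈ A, ω ∈ openConnIn (↑(insert v U) : Set (Fin n)) o a) ↔
      (∃ x ∈ K, s(x, v) ∈ ω) ∧ ∃ a ∈ A, ω ∈ openConnIn (↑(insert v (U \ K)) : Set (Fin n)) v a := by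
  constructor
  · rintro ⟨a, haA, hoa⟩
    have hp : PathIn (openGraph ω) (↑(insert v U) : Set (Fin n)) o a :=
      DCT16.pathIn_of_mem_openConnIn hoa
    have haK : a ∉ K := fun h => Finset.disjoint_left.1 hKA h haA
    obtain ⟨x, y, hxK, -, hyK, hxy, hpy⟩ := hp.last_exit (C := (↑K : Set (Fin n)))
      (Finset.mem_coe.2 ho) (fun h => haK (Finset.mem_coe.1 h))
    have hxK' : x ∈ K := Finset.mem_coe.1 hxK
    rw [openGraph_adj] at hxy
    -- the outer endpoint `y` is `v`: otherwise `y ∈ U` would be joined to `o` inside `U`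
    have hyv : y = v := by
      by_contra hyv
      have hyU : y ∈ (↑U : Set (Fin n)) := by
        have hy : y ∈ (↑(insert v U) : Set (Fin n)) := hpy.left_mem.1
        rw [Finset.coe_insert] at hy
        exact hy.resolve_left hyv
      have hpx : PathIn (openGraph ω) (↑U : Set (Fin n)) o x :=
        (hubPiece_pathIn_of_mem hE ho hxK').mono (Finset.coe_subset.2 hKU)
      exact hyK (Finset.mem_coe.2 ((hE y).2 (DCT16.mem_openConnIn_of_pathIn
        (hpx.tail ((openGraph_adj ω x y).2 hxy) hyU))))
    subst hyv
    refine ⟨⟨x, hxK', hxy.1⟩, a, haA, DCT16.mem_openConnIn_of_pathIn (hpy.mono ?_)⟩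
    rintro z ⟨hz1, hz2⟩
    rw [Finset.mem_coe, Finset.mem_insert, Finset.mem_sdiff]
    rw [Finset.mem_coe, Finset.mem_insert] at hz1
    exact hz1.imp_right fun h => ⟨h, fun h' => hz2 (Finset.mem_coe.2 h')⟩
  · rintro ⟨⟨x, hxK, hxv⟩, a, haA, hva⟩
    have hxv' : x ≠ v := fun h => hvU (h ▸ hKU hxK)
    have hsub1 : (↑K : Set (Fin n)) ⊆ (↑(insert v U) : Set (Fin n)) :=
      Finset.coe_subset.2 (hKU.trans (Finset.subset_insert v U))
    have hsub2 : (↑(insert v (U \ K)) : Set (Fin n)) ⊆ (↑(insert v U) : Set (Fin n)) :=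
      Finset.coe_subset.2 (Finset.insert_subset_insert v Finset.sdiff_subset)
    have hpv : PathIn (openGraph ω) (↑(insert v U) : Set (Fin n)) o v :=
      ((hubPiece_pathIn_of_mem hE ho hxK).mono hsub1).tail ((openGraph_adj ω x v).2 ⟨hxv, hxv'⟩)
        (Finset.mem_coe.2 (Finset.mem_insert_self v U))
    have hpa : PathIn (openGraph ω) (↑(insert v U) : Set (Fin n)) v a :=
      (DCT16.pathIn_of_mem_openConnIn hva).mono hsub2
    exact ⟨a, haA, DCT16.mem_openConnIn_of_pathIn (hpv.trans hpa)⟩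

/-- **Lifting a hub-modified path.**  On `{𝒦_U = K}` (`o ∈ K`), if `v` is joined to `b` in the
hub-modified configuration `Φ_K ω = (ω ∪ pairs(K, K)) \ pairs(K, U \ K)`, then `v` is joined to `b` in `ω`:
an edge of `Φ_K ω` is either an open pair of `ω`, or a pair inside `K`, whose endpoints are joined in `ω`
through `o`. -/
theorem hubPiece_reachable_of_hub {U K : Finset (Fin n)} {o v b : Fin n} (ho : o ∈ K)
    {ω : Set (Sym2 (Fin n))} (hE : ∀ x : Fin n, x ∈ K ↔ ω ∈ openConnIn (↑U : Set (Fin n)) o x)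
    (h : (ω ∪ {e | ∃ x ∈ K, ∃ y ∈ K, e = s(x, y)}) \ {e | ∃ x ∈ K, ∃ y ∈ U \ K, e = s(x, y)} ∈
      openConn v b) :
    (openGraph ω).Reachable v b := by
  have hp := DCT16.pathIn_univ_of_reachable h
  refine DCT16.pathIn_induction (fun z => (openGraph ω).Reachable v z) hp
    (SimpleGraph.Reachable.refl v) ?_
  intro a c _ _ hva hac
  rw [openGraph_adj] at hac
  obtain ⟨⟨hac1 | hac1, -⟩, hne⟩ := hac
  · exact hva.trans ((openGraph_adj ω a c).2 ⟨hac1, hne⟩).reachable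
  · obtain ⟨x, hx, y, hy, hxy⟩ := hac1
    have hox : (openGraph ω).Reachable o x :=
      DCT16.reachable_of_pathIn (hubPiece_pathIn_of_mem hE ho hx)
    have hoy : (openGraph ω).Reachable o y :=
      DCT16.reachable_of_pathIn (hubPiece_pathIn_of_mem hE ho hy)
    have hxy' : (openGraph ω).Reachable x y := hox.symm.trans hoy
    rcases Sym2.eq_iff.1 hxy with ⟨rfl, rfl⟩ | ⟨rfl, rfl⟩
    · exact hva.trans hxy'
    · exact hva.trans hxy'.symm

/-- On `{𝒦_U = K} ∩ I₁ ∩ I₂` one has `o ↔ b`: `o ↔ x` inside `U` for the vertex `x ∈ K` of the open pair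
`s(x, v)`, then `v ↔ b` by `hubPiece_reachable_of_hub`. -/
theorem hubPiece_mem_openConn {U K : Finset (Fin n)} {o b v : Fin n} (ho : o ∈ K) (hKU : K ⊆ U)
    (hvU : v ∉ U) {ω : Set (Sym2 (Fin n))}
    (hE : ∀ x : Fin n, x ∈ K ↔ ω ∈ openConnIn (↑U : Set (Fin n)) o x) (h1 : ∃ x ∈ K, s(x, v) ∈ ω)
    (h2 : (ω ∪ {e | ∃ x ∈ K, ∃ y ∈ K, e = s(x, y)}) \ {e | ∃ x ∈ K, ∃ y ∈ U \ K, e = s(x, y)} ∈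
      openConn v b) :
    ω ∈ openConn o b := by
  obtain ⟨x, hxK, hxv⟩ := h1
  have hxv' : x ≠ v := fun h => hvU (h ▸ hKU hxK)
  have hox : (openGraph ω).Reachable o x :=
    DCT16.reachable_of_pathIn (hubPiece_pathIn_of_mem hE ho hxK)
  have hadj : (openGraph ω).Adj x v := (openGraph_adj ω x v).2 ⟨hxv, hxv'⟩
  exact hox.trans (hadj.reachable.trans (hubPiece_reachable_of_hub ho hE h2))

/-! ### Monotonicity and locality of `I₁`, `I₂` -/

/-- `I₁ = {∃ x ∈ K, s(x, v) open} ∩ {∃ a ∈ A, v ↔ a inside S}` is increasing. -/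
theorem hubPiece_isUpperSet_I1 (A K : Finset (Fin n)) (v : Fin n) (S : Set (Fin n)) :
    IsUpperSet {ω : Set (Sym2 (Fin n)) | (∃ x ∈ K, s(x, v) ∈ ω) ∧ ∃ a ∈ A, ω ∈ openConnIn S v a} := by
  rintro ω ω' hle ⟨⟨x, hx, hxv⟩, a, ha, hva⟩
  exact ⟨⟨x, hx, hle hxv⟩, a, ha, isUpperSet_openConnIn S v a hle hva⟩

/-- `I₂ = {(ω ∪ P) \ M ∈ openConn v b}` is increasing (`ω ↦ (ω ∪ P) \ M` is monotone and `openConn` is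
increasing). -/
theorem hubPiece_isUpperSet_I2 (P M : Set (Sym2 (Fin n))) (v b : Fin n) :
    IsUpperSet {ω : Set (Sym2 (Fin n)) | (ω ∪ P) \ M ∈ openConn v b} := by
  intro ω ω' hle h
  exact isUpperSet_openConn v b (Set.sdiff_subset_sdiff_left (Set.union_subset_union_left P hle)) h

/-- `I₁` is determined by any pair set containing the pairs `s(x, v)`, `x ∈ K`, and the pairs inside `S`. -/
theorem hubPiece_determinedBy_I1 {A K : Finset (Fin n)} {v : Fin n} {S : Set (Fin n)}
    {G : Set (Sym2 (Fin n))} (hG1 : ∀ x ∈ K, s(x, v) ∈ G) (hG2 : S.sym2 ⊆ G) :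
    DeterminedBy {ω : Set (Sym2 (Fin n)) | (∃ x ∈ K, s(x, v) ∈ ω) ∧ ∃ a ∈ A, ω ∈ openConnIn S v a} G := by
  rw [determinedBy_iff]
  intro ω ω' h
  simp only [Set.mem_setOf_eq]
  refine and_congr (exists_congr fun x => and_congr_right fun hx => ?_)
    (exists_congr fun a => and_congr_right fun _ =>
      (determinedBy_iff _ _).1 (DCT16.determinedBy_openConnIn S v a hG2) ω ω' h)
  exact ⟨fun h1 => (((Set.ext_iff.1 h) _).1 ⟨h1, hG1 x hx⟩).1,
    fun h1 => (((Set.ext_iff.1 h) _).2 ⟨h1, hG1 x hx⟩).1⟩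

/-- **The hub-modified configuration does not read the pairs of `F`.**  If every pair outside `G` is of the
form `s(x, y)`, `x ∈ K`, `y ∈ U`, then configurations agreeing on `G` have the same `Φ_K` (a pair `s(x, y)`
with `x, y ∈ K` is always in `Φ_K`, one with `x ∈ K`, `y ∈ U \ K` never). -/
theorem hubPiece_hub_eq_of_inter_eq {U K : Finset (Fin n)} {G : Set (Sym2 (Fin n))}
    (hG : ∀ e, e ∉ G → ∃ x ∈ K, ∃ y ∈ U, e = s(x, y)) {ω ω' : Set (Sym2 (Fin n))}
    (h : ω ∩ G = ω' ∩ G) :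
    (ω ∪ {e | ∃ x ∈ K, ∃ y ∈ K, e = s(x, y)}) \ {e | ∃ x ∈ K, ∃ y ∈ U \ K, e = s(x, y)} =
      (ω' ∪ {e | ∃ x ∈ K, ∃ y ∈ K, e = s(x, y)}) \ {e | ∃ x ∈ K, ∃ y ∈ U \ K, e = s(x, y)} := by
  ext e
  by_cases heG : e ∈ G
  · have key : e ∈ ω ↔ e ∈ ω' :=
      ⟨fun h1 => (((Set.ext_iff.1 h) _).1 ⟨h1, heG⟩).1, fun h1 => (((Set.ext_iff.1 h) _).2 ⟨h1, heG⟩).1⟩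
    simp only [Set.mem_sdiff, Set.mem_union, key]
  · obtain ⟨x, hx, y, hy, rfl⟩ := hG e heG
    by_cases hyK : y ∈ K
    · have hin : s(x, y) ∈ {e : Sym2 (Fin n) | ∃ x ∈ K, ∃ y ∈ K, e = s(x, y)} := ⟨x, hx, y, hyK, rfl⟩
      simp only [Set.mem_sdiff, Set.mem_union, hin, or_true, true_and]
    · have hout : s(x, y) ∈ {e : Sym2 (Fin n) | ∃ x ∈ K, ∃ y ∈ U \ K, e = s(x, y)} :=
        ⟨x, hx, y, Finset.mem_sdiff.2 ⟨hy, hyK⟩, rfl⟩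
      simp only [Set.mem_sdiff, hout, not_true_eq_false, and_false]

/-- `I₂ = {Φ_K ω ∈ openConn v b}` is determined by any pair set off which all pairs are of the form
`s(x, y)`, `x ∈ K`, `y ∈ U`. -/
theorem hubPiece_determinedBy_I2 {U K : Finset (Fin n)} (v b : Fin n) {G : Set (Sym2 (Fin n))}
    (hG : ∀ e, e ∉ G → ∃ x ∈ K, ∃ y ∈ U, e = s(x, y)) :
    DeterminedBy {ω : Set (Sym2 (Fin n)) | (ω ∪ {e | ∃ x ∈ K, ∃ y ∈ K, e = s(x, y)}) \
      {e | ∃ x ∈ K, ∃ y ∈ U \ K, e = s(x, y)} ∈ openConn v b} G := by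
  rw [determinedBy_iff]
  intro ω ω' h
  simp only [Set.mem_setOf_eq]
  rw [hubPiece_hub_eq_of_inter_eq hG h]

/-! ### Assembly -/

/-- **Abstract assembly of the hub piece bound.**  If `E` is determined by a finite pair set `F` and the
increasing events `I₁, I₂` by `Fᶜ`, if `Piv ∩ E = E ∩ I₁` and `E ∩ I₁ ∩ I₂ ⊆ C`, then
`μ(Piv ∩ E ∩ Cᶜ) ≤ μ(Piv ∩ E) · μ(I₂ᶜ)`: independence and Harris give
`μ(E ∩ I₁ ∩ I₂) = μ E · μ(I₁ ∩ I₂) ≥ μ E · μ I₁ · μ I₂ = μ(E ∩ I₁) · μ I₂ = μ(Piv ∩ E) · μ I₂`, and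
`μ(Piv ∩ E ∩ Cᶜ) = μ(Piv ∩ E) − μ(Piv ∩ E ∩ C) ≤ μ(Piv ∩ E)(1 − μ I₂)`. -/
theorem hubPiece_assembly (w : Sym2 (Fin n) → unitInterval) (F : Finset (Sym2 (Fin n)))
    {Piv E I₁ I₂ C : Set (Set (Sym2 (Fin n)))} (hE : DeterminedBy E (↑F : Set (Sym2 (Fin n))))
    (hI₁ : DeterminedBy I₁ (↑F : Set (Sym2 (Fin n)))ᶜ) (hI₂ : DeterminedBy I₂ (↑F : Set (Sym2 (Fin n)))ᶜ)
    (hI₁u : IsUpperSet I₁) (hI₂u : IsUpperSet I₂) (hPiv : Piv ∩ E = E ∩ I₁) (hC : E ∩ I₁ ∩ I₂ ⊆ C) :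
    (prodBernoulli w).real (Piv ∩ E ∩ Cᶜ) ≤
      (prodBernoulli w).real (Piv ∩ E) * (prodBernoulli w).real I₂ᶜ := by
  set μ := prodBernoulli w with hμ
  have h1 : μ.real (E ∩ (I₁ ∩ I₂)) = μ.real E * μ.real (I₁ ∩ I₂) :=
    prodBernoulli_real_inter_of_determinedBy w F hE (hI₁.inter hI₂) MeasurableSet.of_discrete
      MeasurableSet.of_discrete
  have h2 : μ.real (E ∩ I₁) = μ.real E * μ.real I₁ :=
    prodBernoulli_real_inter_of_determinedBy w F hE hI₁ MeasurableSet.of_discrete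
      MeasurableSet.of_discrete
  have h3 : μ.real I₁ * μ.real I₂ ≤ μ.real (I₁ ∩ I₂) :=
    prodBernoulli_harris w hI₁u hI₂u MeasurableSet.of_discrete MeasurableSet.of_discrete
  have hsub : E ∩ (I₁ ∩ I₂) ⊆ Piv ∩ E ∩ C := by
    rintro ω ⟨hωE, hωI₁, hωI₂⟩
    have hωP : ω ∈ Piv ∩ E := by rw [hPiv]; exact ⟨hωE, hωI₁⟩
    exact ⟨hωP, hC ⟨⟨hωE, hωI₁⟩, hωI₂⟩⟩
  have h4 : μ.real (Piv ∩ E) * μ.real I₂ ≤ μ.real (Piv ∩ E ∩ C) :=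
    calc μ.real (Piv ∩ E) * μ.real I₂ = μ.real E * (μ.real I₁ * μ.real I₂) := by
          rw [hPiv, h2, mul_assoc]
      _ ≤ μ.real E * μ.real (I₁ ∩ I₂) := mul_le_mul_of_nonneg_left h3 measureReal_nonneg
      _ = μ.real (E ∩ (I₁ ∩ I₂)) := h1.symm
      _ ≤ μ.real (Piv ∩ E ∩ C) := measureReal_mono hsub (measure_ne_top _ _)
  have h5 : μ.real (Piv ∩ E ∩ C) + μ.real (Piv ∩ E ∩ Cᶜ) = μ.real (Piv ∩ E) := by
    rw [← Set.sdiff_eq]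
    exact measureReal_inter_add_sdiff MeasurableSet.of_discrete
  have h6 : μ.real I₂ᶜ = 1 - μ.real I₂ := probReal_compl_eq_one_sub MeasurableSet.of_discrete
  have h7 : μ.real (Piv ∩ E) * (1 - μ.real I₂) = μ.real (Piv ∩ E) - μ.real (Piv ∩ E) * μ.real I₂ := by
    ring
  rw [h6, h7]
  linarith

/-- **Hub piece lemma** (stub `stub_hubPiece` of line `SketchR2I5`, heart of the ordering bound).  Fix a
vertex set `U`, a vertex `v ∉ U` and a relay-free `K` with `o ∈ K ⊆ U`.  On the event that the open cluster of
`o` INSIDE `U` is exactly `K` (`𝒦_U = K`) and `o` reaches a relay inside `U ∪ {v}`, the probability of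
`o ↮ b` is at most `μ(Piv ∩ {𝒦_U = K})` times the unreliability of `v` in the hub-modified configuration
`Φ_K ω := (ω ∪ pairs(K)) ∖ pairs(K, U ∖ K)`:
`μ(Piv ∩ {𝒦_U = K} ∩ {o ↮ b}) ≤ μ(Piv ∩ {𝒦_U = K}) · μ{Φ_K ω ∉ openConn v b}`.
Proof: `hubPiece_assembly` with `F :=` the pairs `s(x, y)`, `x ∈ K`, `y ∈ U`; `E := {𝒦_U = K}` is determined
by `F` (`hubPiece_determinedBy_cluster`), `I₁ := {∃ x ∈ K, s(x,v) open} ∩ {v ↔ A inside insert v (U \ K)}` and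
`I₂ := {Φ_K ω ∈ openConn v b}` are increasing and determined by `Fᶜ`, `Piv ∩ E = E ∩ I₁`
(`hubPiece_piv_iff`) and `E ∩ I₁ ∩ I₂ ⊆ {o ↔ b}` (`hubPiece_mem_openConn`). -/
theorem stub_hubPiece :
    ∀ (n : ℕ) (w : Sym2 (Fin n) → unitInterval) (A U K : Finset (Fin n)) (o b v : Fin n),
      o ∈ K → K ⊆ U → v ∉ U → Disjoint K A →
      (prodBernoulli w).real
          ({ω | ∃ a ∈ A, ω ∈ openConnIn (↑(insert v U) : Set (Fin n)) o a} ∩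
            {ω | ∀ x : Fin n, x ∈ K ↔ ω ∈ openConnIn (↑U : Set (Fin n)) o x} ∩ (openConn o b)ᶜ) ≤
        (prodBernoulli w).real
            ({ω | ∃ a ∈ A, ω ∈ openConnIn (↑(insert v U) : Set (Fin n)) o a} ∩
              {ω | ∀ x : Fin n, x ∈ K ↔ ω ∈ openConnIn (↑U : Set (Fin n)) o x}) *
          (prodBernoulli w).real
            {ω | (ω ∪ {e | ∃ x ∈ K, ∃ y ∈ K, e = s(x, y)}) \ {e | ∃ x ∈ K, ∃ y ∈ U \ K, e = s(x, y)} ∉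
              openConn v b} := by
  intro n w A U K o b v ho hKU hvU hKA
  -- the pairs inside `U` meeting `K`
  set F : Finset (Sym2 (Fin n)) :=
    Finset.univ.filter (fun e : Sym2 (Fin n) => ∃ x ∈ K, ∃ y ∈ U, e = s(x, y)) with hF
  have hF1 : ∀ x ∈ K, ∀ y ∈ U, s(x, y) ∈ (↑F : Set (Sym2 (Fin n))) := fun x hx y hy =>
    Finset.mem_coe.2 (Finset.mem_filter.2 ⟨Finset.mem_univ _, x, hx, y, hy, rfl⟩)
  have hF2 : ∀ e, e ∉ (↑F : Set (Sym2 (Fin n)))ᶜ → ∃ x ∈ K, ∃ y ∈ U, e = s(x, y) := by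
    intro e he
    have he' : e ∈ (↑F : Set (Sym2 (Fin n))) := by
      by_contra h'
      exact he h'
    exact (Finset.mem_filter.1 (Finset.mem_coe.1 he')).2
  have hG1 : ∀ x ∈ K, s(x, v) ∈ (↑F : Set (Sym2 (Fin n)))ᶜ := by
    intro x hx hxF
    obtain ⟨x', hx', y, hy, hxy⟩ := (Finset.mem_filter.1 (Finset.mem_coe.1 hxF)).2
    rcases Sym2.eq_iff.1 hxy with ⟨-, rfl⟩ | ⟨-, rfl⟩
    · exact hvU hy
    · exact hvU (hKU hx')
  have hG2 : (↑(insert v (U \ K)) : Set (Fin n)).sym2 ⊆ (↑F : Set (Sym2 (Fin n)))ᶜ := by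
    intro e he heF
    obtain ⟨x, hx, y, -, rfl⟩ := (Finset.mem_filter.1 (Finset.mem_coe.1 heF)).2
    have hx' : x ∈ (↑(insert v (U \ K)) : Set (Fin n)) := (Set.mk_mem_sym2_iff.1 he).1
    rw [Finset.mem_coe, Finset.mem_insert, Finset.mem_sdiff] at hx'
    rcases hx' with rfl | ⟨-, hxK⟩
    · exact hvU (hKU hx)
    · exact hxK hx
  have hEdet := hubPiece_determinedBy_cluster (o := o) ho hKU hF1
  have hI₁det := hubPiece_determinedBy_I1 (A := A) hG1 hG2
  have hI₂det := hubPiece_determinedBy_I2 (U := U) (K := K) v b hF2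
  have hI₁up := hubPiece_isUpperSet_I1 A K v (↑(insert v (U \ K)) : Set (Fin n))
  have hI₂up := hubPiece_isUpperSet_I2 {e : Sym2 (Fin n) | ∃ x ∈ K, ∃ y ∈ K, e = s(x, y)}
    {e : Sym2 (Fin n) | ∃ x ∈ K, ∃ y ∈ U \ K, e = s(x, y)} v b
  have hPivE : ({ω | ∃ a ∈ A, ω ∈ openConnIn (↑(insert v U) : Set (Fin n)) o a} ∩
      {ω | ∀ x : Fin n, x ∈ K ↔ ω ∈ openConnIn (↑U : Set (Fin n)) o x} : Set (Set (Sym2 (Fin n)))) =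
      {ω | ∀ x : Fin n, x ∈ K ↔ ω ∈ openConnIn (↑U : Set (Fin n)) o x} ∩
        {ω | (∃ x ∈ K, s(x, v) ∈ ω) ∧
          ∃ a ∈ A, ω ∈ openConnIn (↑(insert v (U \ K)) : Set (Fin n)) v a} := by
    ext ω
    constructor
    · rintro ⟨hP, hE⟩
      exact ⟨hE, (hubPiece_piv_iff ho hKU hvU hKA hE).1 hP⟩
    · rintro ⟨hE, hI⟩
      exact ⟨(hubPiece_piv_iff ho hKU hvU hKA hE).2 hI, hE⟩
  have hC : {ω | ∀ x : Fin n, x ∈ K ↔ ω ∈ openConnIn (↑U : Set (Fin n)) o x} ∩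
      {ω | (∃ x ∈ K, s(x, v) ∈ ω) ∧
        ∃ a ∈ A, ω ∈ openConnIn (↑(insert v (U \ K)) : Set (Fin n)) v a} ∩
      {ω : Set (Sym2 (Fin n)) | (ω ∪ {e | ∃ x ∈ K, ∃ y ∈ K, e = s(x, y)}) \
        {e | ∃ x ∈ K, ∃ y ∈ U \ K, e = s(x, y)} ∈ openConn v b} ⊆ openConn o b := by
    rintro ω ⟨⟨hE, hI1⟩, hI2⟩
    exact hubPiece_mem_openConn ho hKU hvU hE hI1.1 hI2
  exact hubPiece_assembly w F hEdet hI₁det hI₂det hI₁up hI₂up hPivE hC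

end HubPiece

end Summit.CriticalPhenomena.PercolationContinuityZ3.Theorems
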